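/-
Origin: expansion seat `planner-pub-hodgecm-pv01-g5-0`, handover #5 2026-08-18T07:39:54Z (`HOME/pub-hodgecm-pv01-g5/lean/Pv01g5/EndStateHCCM.lean`, md5 6f0839c7, 112 lines);
landed by the gen-7 packager in gate run 26 as `HodgeCM/PerL34/EndStateHCCM.lean` (import ^import Pv[0-9]+g[0-9]+\.→import HodgeCM.PerL34. ×2).
-/
/-
# `HC_CM` END TO END: model axioms + the PerL-side end state + the [QW8]-side (E8) descent facts

Origin: DAG-node prover seat `planner-pub-hodgecm-pv01-g5-0` (gen 5 of `pub-hodgecm-pv01`), 2026-08-18, handover #5,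
for gate run 26.  NEW additive leaf under `HodgeCM/PerL34/`.  Imports: `Pv01g5.EndStateThm44`, `Pv01g5.EndStateShadow`
(handovers #1, #2 of this seat, run 26; import prefix `Pv01g5.` ↦ `HodgeCM.PerL34.` on landing) and the run-24 tree
files `HodgeCM.StubTree.Qw8GysinDescent` (qw8-g4: the [QW8]-side presentation of record (E8),
`Assembly.COR_CM_of_descentFacts`) and `HodgeCM.Assembly.CorCMEndState` (`Assembly.COR_CM_endState`).  Mathlib + the package only; `#print axioms` ⊆ {propext, Classical.choice,
Quot.sound}; no placeholders.  Nothing cited, nothing posited (ABSOLUTE RULE): compositions of landed theorems.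

Purpose.  No theorem of the tree composes the PerL HEADLINE OF RECORD (`AssemblyRoutes.perL_of_openCharsWeilLeavesCRΔ`,
thirteen non-`M` binders) with the [QW8]-side presentation of record (E8) (`Assembly.COR_CM_of_descentFacts`: the
realisation input `RealisationExistsFace` + N1–N4 + F4 `Fact_cupAlg` + F5 `Fact_cupAssoc` + F7d `Fact_gysinDescent` +
M40 `Fact_dimProd`) into the cell's top statement `U.HC_CM`; `Assembly.COR_CM_endState` does it for prl1's ten-field
record `T.Inputs` and the OLDER [QW8] list (`Qw8ExtProd`/`Qw8DualPushPull`/`Qw8Milne` + M29/M30).  This file supplies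
the composition under one name, in both spellings:

* `EndState.realisationExists (M) (E) : U.RealisationExistsPerL ∧ U.RealisationExistsFace`;
* `hcCM_of_endState_descentFacts (M) (E : EndState T Pc) (hN1 hN2 hN3 hN4 h4 h5 h7d hd) : U.HC_CM`;
* `hcCM_of_openCharsWeilLeavesCRΔ_descentFacts` — the same with the thirteen PerL-side binders EXPLICIT, in the order
  and with the types of the headline of record (for the audited list);
* `endToEnd (M) (E) (…(E8)…) : U.HC_CM ∧ U.PerL44 ∧ U.PerL ∧ U.PeriodThmF ∧ U.W_RK4` — every conclusion of record of
  the cell from the two end states at once;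
* `hcCM_of_endState_oldQw8` — the end state plugged into `Assembly.COR_CM_endState` (older [QW8] list), for comparison.

Binder count of the end-to-end statement: `M` (28 model facts) + 13 (PerL side; 5 print/design + 8 dictionary/open,
see `EndStateLinks`) + 8 ([QW8] side (E8)) — nothing else.
-/
import Summits.HodgeConjecture.HodgeCM.PerL34.EndStateThm44
import Summits.HodgeConjecture.HodgeCM.PerL34.EndStateShadow
import Summits.HodgeConjecture.HodgeCM.StubTree.Qw8GysinDescent
import Summits.HodgeConjecture.HodgeCM.Assembly.CorCMEndState

/-! PORT of `HodgeCM/PerL34/EndStateHCCM.lean` (HodgeCMPerL run 82) — verbatim mechanical port; provenance in the PORT header line. -/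

set_option autoImplicit false

noncomputable section

open HodgeCM.Prior.Perl34File HodgeCM.Prior.Perl34File.Perl34 HodgeCM.PerL34.ArchC

namespace HodgeCM

namespace PerL34

namespace EndStateHCCM

open Universe Universe.ThetaModel AssemblyRoutes EndStateShadow EndStateThm44 CharSpansFinal

variable {U : Universe} {T : U.ThetaModel}
variable {Pc : ∀ {L : CMField} {ι₁ : L →+* ℂ} (V : HermSpace3 L ι₁) (c : SeesawCtx L),
  C4a.PointedCore (T.core V c)}

/-- Both realisation inputs of the [QW8] side from the PerL-side end state (`ThetaModel.realisationExists_of''`). -/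
theorem _root_.HodgeCM.PerL34.EndStateShadow.EndState.realisationExists (M : U.ModelAxioms) (E : EndState T Pc) :
    U.RealisationExistsPerL ∧ U.RealisationExistsFace :=
  T.realisationExists_of'' M (E.inputs M) E.h07

/-- **`HC_CM` END TO END (presentations of record on both sides).**  Model axioms + the PerL-side end state (the
thirteen binders of `perL_of_openCharsWeilLeavesCRΔ`, bundled) + the [QW8]-side (E8) list: N1 `Fact_cupExterior`,
N2 `Fact_cup_hodge`, N3 `Fact_pull_H0`, N4 `Fact_hodge_F0`, F4 `Fact_cupAlg`, F5 `Fact_cupAssoc`, F7d `Fact_gysinDescent`,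
M40 `Fact_dimProd`. -/
theorem hcCM_of_endState_descentFacts (M : U.ModelAxioms) (E : EndState T Pc)
    (hN1 : U.Fact_cupExterior) (hN2 : U.Fact_cup_hodge) (hN3 : U.Fact_pull_H0) (hN4 : U.Fact_hodge_F0)
    (h4 : U.Fact_cupAlg) (h5 : U.Fact_cupAssoc) (h7d : U.Fact_gysinDescent) (hd : U.Fact_dimProd) : U.HC_CM :=
  Assembly.COR_CM_of_descentFacts U M (E.realisationExists M).2 hN1 hN2 hN3 hN4 h4 h5 h7d hd

/-- **Every conclusion of record at once** from the two end states: `HC_CM`, PerL Theorem 4.4 as printed (`PerL44`),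
its `∃`-weakening `PerL`, the period theorem face F and `W_RK4`. -/
theorem endToEnd (M : U.ModelAxioms) (E : EndState T Pc)
    (hN1 : U.Fact_cupExterior) (hN2 : U.Fact_cup_hodge) (hN3 : U.Fact_pull_H0) (hN4 : U.Fact_hodge_F0)
    (h4 : U.Fact_cupAlg) (h5 : U.Fact_cupAssoc) (h7d : U.Fact_gysinDescent) (hd : U.Fact_dimProd) :
    U.HC_CM ∧ U.PerL44 ∧ U.PerL ∧ U.PeriodThmF ∧ U.W_RK4 :=
  have h := endState_conclusions M T E.h07 E.h09a E.h09b E.hM38 E.hAlb E.h12b E.hbr E.hQ Pc E.A12 E.A34 E.hch E.hW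
  ⟨hcCM_of_endState_descentFacts M E hN1 hN2 hN3 hN4 h4 h5 h7d hd, h.1, h.2.1, h.2.2.2.1, h.2.2.2.2.1⟩

/-- For comparison: the end state plugged into the OLDER [QW8]-side list of `Assembly.COR_CM_endState`
(M29 `Fact_weightSpan`, M30 `Fact_weightHodge`, `Qw8ExtProd`, `Qw8DualPushPull`, `Qw8Milne`). -/
theorem hcCM_of_endState_oldQw8 (M : U.ModelAxioms) (E : EndState T Pc) (h29 : U.Fact_weightSpan)
    (h30 : U.Fact_weightHodge) (hE : U.Qw8ExtProd) (hD : U.Qw8DualPushPull) (hMi : U.Qw8Milne) : U.HC_CM :=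
  Assembly.COR_CM_endState U M h29 h30 hE hD hMi T (E.inputs M) E.h07

end EndStateHCCM

/-- **`HC_CM` END TO END, binders explicit** (audited-list form): the model axioms `M`; the thirteen PerL-side
binders in the order and with the types of the headline of record `AssemblyRoutes.perL_of_openCharsWeilLeavesCRΔ`
(N07, N09a, N09b, M38, `Fact_thetaAlbanese`, N12b, the seesaw-bridge and Qaut-bridge records, the core points `Pc`,
the two Arch-C data, `Open_chars`, `WeilStepsInputCRΔ`); the eight [QW8]-side (E8) facts (N1–N4, F4, F5, F7d, M40).
Conclusion: `U.HC_CM`. -/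
theorem hcCM_of_openCharsWeilLeavesCRΔ_descentFacts {U : Universe} (M : U.ModelAxioms) (T : U.ThetaModel)
    (h07 : N07_hodgeRiemann20 U) (h09a : N09a_embCover T) (h09b : N09b_innerEmb T)
    (hM38 : U.Fact_cmInflation) (hAlb : T.Fact_thetaAlbanese) (h12b : N12b_signRecipe T)
    (hbr : ∀ {L : CMField} {ι₁ : L →+* ℂ} (V : HermSpace3 L ι₁) (c : SeesawCtx L), T.GoodCtx ι₁ c →
      Nonempty (SeesawDictionary.SeesawBridge T V c (T.t12 V c) 0 1))
    (hQ : ∀ {L : CMField} {ι₁ : L →+* ℂ} (V : HermSpace3 L ι₁) (c : SeesawCtx L), T.GoodCtx ι₁ c →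
      Nonempty (QautDictionary.QautBridge T V c (T.t34 V c) 2 3))
    (Pc : ∀ {L : CMField} {ι₁ : L →+* ℂ} (V : HermSpace3 L ι₁) (c : SeesawCtx L),
      C4a.PointedCore (T.core V c))
    (A12 : ∀ {L : CMField} {ι₁ : L →+* ℂ} (V : HermSpace3 L ι₁) (c : SeesawCtx L),
      T.GoodCtx ι₁ c → Nonempty (ArchCDatum (T.core V c) (T.t12 V c) (Pc V c)))
    (A34 : ∀ {L : CMField} {ι₁ : L →+* ℂ} (V : HermSpace3 L ι₁) (c : SeesawCtx L),
      T.GoodCtx ι₁ c → Nonempty (ArchCDatum (T.core V c) (T.t34 V c) (Pc V c)))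
    (hch : T.Open_chars) (hW : CharSpansFinal.WeilStepsInputCRΔ T)
    (hN1 : U.Fact_cupExterior) (hN2 : U.Fact_cup_hodge) (hN3 : U.Fact_pull_H0) (hN4 : U.Fact_hodge_F0)
    (h4 : U.Fact_cupAlg) (h5 : U.Fact_cupAssoc) (h7d : U.Fact_gysinDescent) (hd : U.Fact_dimProd) : U.HC_CM :=
  EndStateHCCM.hcCM_of_endState_descentFacts M
    (⟨h07, h09a, h09b, hM38, hAlb, h12b, hbr, hQ, A12, A34, hch, hW⟩ : EndStateShadow.EndState T Pc)
    hN1 hN2 hN3 hN4 h4 h5 h7d hd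

end PerL34

end HodgeCM

end
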